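import Summits.CriticalPhenomena.CardyFormulaZ2.Theorems.CardyAnchoredRigidityStretchedPullbackNotTargetBlindEndgame

/-!
# Route CardyAnchoredRigidity — `StretchedPullbackNotTargetBlind` (item stmt-CriticalPhenomena-14488)

STRETCHED PULLBACK IS NOT TARGET-BLIND (card P3, negative half). The item was filed informally
(no Lean signature at the time of writing); this file proves the following typed form, over the
tree's vocabulary and with FEWER hypotheses than the informal text (only `IsSLELaw 6` and target
independence of `S` are used; conformal covariance, the Markov property, restriction locality and
non-tracing are not needed):

  for `c ∈ (0, 1/3)`, every target-anchored field `Φ : ℂ → ℂ ≃ₜ ℂ` acting as the radial stretches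
  `Φ b z = b + (z - b)|z - b|^{2c/(1-c)}`, every chordal family `S` of SLE₆ laws
  (`∀ D, IsSLELaw 6 D (S D)`) which is target independent, and every `P` with
  `P D = (Φ (D.pt 1))⁻¹_* S ((Φ (D.pt 1)) D)` for all `D`:
  `¬ P.IsTargetIndependent ∧ ∃ D, P D ≠ S D`                      (`stretchedPullback_not_targetIndependent`).

Suggested route declaration (for the planner's `set-signature`; this theorem then closes it in one line):
`∀ (c : ℝ), c ∈ Set.Ioo (0:ℝ) (1/3) → ∀ (Φ : ℂ → ℂ ≃ₜ ℂ), (∀ b z : ℂ, Φ b z = b + (z - b) *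
((‖z - b‖ ^ (2 * c / (1 - c)) : ℝ) : ℂ)) → ∀ (S : ChordalFamily), (∀ D, IsSLELaw 6 D (S D)) →
S.IsTargetIndependent → ∀ (P : ChordalFamily), (∀ D : DobrushinDomain, P D =
(S (D.map (Φ (D.pt 1)))).map (CurveClass.map ((Φ (D.pt 1)).symm : C(ℂ, ℂ)))) →
¬ P.IsTargetIndependent ∧ ∃ D, P D ≠ S D`
(extra hypotheses on `S` — conformal covariance, `IsDomainMarkov`, `IsLocal`, non-tracing — may be
added freely; they are not used).

Proof: `not_isTargetIndependent_of_isStretch` (file `…Endgame`, which documents the argument: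
Cardy's formula for SLE₆ in two stretched test rectangles, symmetric Riemann charts with explicit
boundary correspondence along the real axis, and a flat-versus-linear incompatibility at the
common mark `1`). The second clause follows from the first since `S` itself is target independent.
-/

noncomputable section

open Set

namespace Summit.CriticalPhenomena.CardyFormulaZ2.Theorems

open Literature.Probability.RandomPlanarGeometry
open Summit.CriticalPhenomena.CardyFormulaZ2.Theorems.StretchedPullback

/-- **Stretched pullback is not target-blind** (route CardyAnchoredRigidity, item
stmt-CriticalPhenomena-14488, typed form). Let `c ∈ (0, 1/3)` and let `Φ b` be the radial stretch
`z ↦ b + (z - b)|z - b|^{2c/(1-c)}` about `b`, for every `b ∈ ℂ`. Let `S` be a chordal family of SLE₆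
laws (`IsSLELaw 6 D (S D)` for all Dobrushin domains `D`) satisfying the splitting form of locality
(`IsTargetIndependent`), and let `P` be its target-anchored pullback,
`P D = (Φ (D.pt 1))⁻¹_* S ((Φ (D.pt 1)) D)`. Then `P` is not target independent, and `P D ≠ S D` for
some `D`. -/
theorem stretchedPullback_not_targetIndependent {c : ℝ} (hc : c ∈ Ioo (0 : ℝ) (1 / 3))
    (Φ : ℂ → ℂ ≃ₜ ℂ)
    (hΦ : ∀ b z : ℂ, Φ b z = b + (z - b) * ((‖z - b‖ ^ (2 * c / (1 - c)) : ℝ) : ℂ))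
    (S : ChordalFamily) (hS : ∀ D : DobrushinDomain, IsSLELaw 6 D (S D))
    (hTI : S.IsTargetIndependent) (P : ChordalFamily)
    (hP : ∀ D : DobrushinDomain,
      P D = (S (D.map (Φ (D.pt 1)))).map (CurveClass.map ((Φ (D.pt 1)).symm : C(ℂ, ℂ)))) :
    ¬ P.IsTargetIndependent ∧ ∃ D, P D ≠ S D := by
  set α : ℝ := 2 * c / (1 - c) with hα_def
  have hc1 : 0 < 1 - c := by linarith [hc.2]
  have hα : 0 < α := div_pos (by linarith [hc.1]) hc1
  have hα1 : α ≤ 1 := by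
    rw [hα_def, div_le_one hc1]
    linarith [hc.2]
  have h0 : ∀ z : ℂ, Φ 0 z = stretchFn 0 α z := fun z => by
    rw [hΦ 0 z, stretchFn]
    push_cast
    ring_nf
  have h1 : ∀ z : ℂ, Φ 1 z = stretchFn 1 α z := fun z => by
    rw [hΦ 1 z, stretchFn]
    push_cast
    ring_nf
  have hnot : ¬ P.IsTargetIndependent :=
    not_isTargetIndependent_of_isStretch hα hα1 h0 h1 hS hTI hP
  refine ⟨hnot, ?_⟩
  by_contra hall
  push Not at hall
  have hPS : P = S := funext hall
  exact hnot (hPS ▸ hTI)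

end Summit.CriticalPhenomena.CardyFormulaZ2.Theorems
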